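import Mathlib
import Summits.MatrixMultiplication.MatrixMultiplication.Theorems.SubgroupIdentityDesigns.Negative.CellTwoOneClosed

/-!
# No `(2,1)` level-one witness on three Cartan-normaliser members (unconditional, `p ≥ 7`)

Route `LevelGradedCohnUmans`, crux `SubgroupIdentityDesigns` (stmt-MatrixMultiplication-14079), cell
`(m,k) = (2,1)`.  VALUE = THEOREM on one cell, NOT summit progress; the crux stays open and untouched.

`CellTwoOneClosed.no_levelOne_witness_of_conj_singerNormal` excludes triples whose members are each
conjugate into a NON-SPLIT Cartan normaliser `N(C_n)`.  The split case was already impossible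
(`DicksonFamilyI.not_conj_monomial_of_image_eq`: a subgroup conjugate into `N(T_s)` never has
projective image of order exactly `p + 1`, while `familyI_of_images_le` forces exactly `p + 1`).
Packaging the two gives the UNCONDITIONAL statement of this file:

* `no_levelOne_witness_of_conj_cartan` (`p ≥ 7`, `0 < ε ≤ 1`): if each member of a subgroup-TPP
  triple in `GL₂(𝔽_p)` carrying a level-one identity design is conjugate into the normaliser of a
  split torus `N(T_s)` (monomial matrices) or of a non-split torus `N(C_n)`, the level-one crux
  inequality fails.

Hence (for every prime `p ≥ 7` and every `0 < ε ≤ 1`) a `(2,1)` level-one witness must contain a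
member that is conjugate into NO Cartan normaliser; by `CellStatus` its members are `p`-free, so under
Dickson's classification such a member has exceptional projective image (`A₄`, `S₄`, `A₅`), which
`CellTwoOneStatus` / `CellTwoOneClosed` exclude for `p ≥ 47`.  The only inputs of the whole `(2,1)`
verdict that are not theorems of the tree are therefore: Dickson's list (PAPER) and the range
`p ≤ 43` (DATA, censuses in the route folder).
-/

set_option linter.dupNamespace false

noncomputable section

open scoped BigOperators Classical

open Summit.MatrixMultiplication.MatrixMultiplication.Theorems.LieRankDesigns.Negative (GLm Mat budget)

namespace Summit.MatrixMultiplication.MatrixMultiplication.Theorems.SubgroupIdentityDesigns.Negative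

section CartanMembers

open Literature.Barriers.MatrixMultiplication (SubgroupTPP)

variable {p : ℕ} [hp : Fact p.Prime]

/-- A subgroup with a free vector that is conjugate into a Cartan normaliser (split or non-split)
has projective image of order `≤ p + 1` (`p ≥ 3`; packaging of `image_le_of_conj_monomial` and
`image_le_of_conj_singerNormal`). -/
theorem image_le_of_conj_cartan (hp3 : 3 ≤ p) {n : ZMod p} (hn : ∀ x : ZMod p, x * x ≠ n)
    {H : Subgroup (GLm p 2)}
    (hH : (∃ g : GLm p 2, ∀ x ∈ H, IsMonomial (g * x * g⁻¹)) ∨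
      ∃ g : GLm p 2, ∀ x ∈ H, IsSingerNormal n (g * x * g⁻¹))
    (hfree : ∃ a : Fin 2 → ZMod p, a ≠ 0 ∧
      ∀ h ∈ H, ((h : GLm p 2) : Mat p 2).mulVec a = a → h = 1) :
    Nat.card (H.map (QuotientGroup.mk' (scalarHom p 2).range)) ≤ p + 1 := by
  rcases hH with ⟨g, hg⟩ | ⟨g, hg⟩
  · exact image_le_of_conj_monomial hp3 hg hfree
  · exact image_le_of_conj_singerNormal hp3 hn hg hfree

/-- **NO LEVEL-ONE WITNESS ON THREE CARTAN-NORMALISER MEMBERS** (unconditional; `p ≥ 7`,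
`0 < ε ≤ 1`).  If `(H₁, H₂, H₃)` is subgroup-TPP in `GL₂(𝔽_p)`, carries a level-`1` identity design,
and each `Hᵢ` is conjugate into `N(T_s)` (monomial matrices) or into `N(C_n)` (`n` a fixed
non-square), then the level-one crux inequality fails. -/
theorem no_levelOne_witness_of_conj_cartan (hp7 : 7 ≤ p) {n : ZMod p}
    (hn : ∀ x : ZMod p, x * x ≠ n) {ε : ℝ} (hε : 0 < ε) (hε1 : ε ≤ 1)
    {H₁ H₂ H₃ : Subgroup (GLm p 2)} (htpp : SubgroupTPP H₁ H₂ H₃)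
    (hdesign : ∃ c : Mat p 2 → ℂ, (∀ M, 1 < M.rank → c M = 0) ∧
      (∑ M, c M * ZMod.stdAddChar (Matrix.trace (M * ((1 : GLm p 2) : Mat p 2)))) = 1 ∧
      ∀ a ∈ H₁, ∀ b ∈ H₂, ∀ g ∈ H₃, a * b * g ≠ 1 →
        (∑ M, c M *
          ZMod.stdAddChar (Matrix.trace (M * ((a * b * g : GLm p 2) : Mat p 2)))) = 0)
    (h₁ : (∃ g : GLm p 2, ∀ x ∈ H₁, IsMonomial (g * x * g⁻¹)) ∨
      ∃ g : GLm p 2, ∀ x ∈ H₁, IsSingerNormal n (g * x * g⁻¹))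
    (h₂ : (∃ g : GLm p 2, ∀ x ∈ H₂, IsMonomial (g * x * g⁻¹)) ∨
      ∃ g : GLm p 2, ∀ x ∈ H₂, IsSingerNormal n (g * x * g⁻¹))
    (h₃ : (∃ g : GLm p 2, ∀ x ∈ H₃, IsMonomial (g * x * g⁻¹)) ∨
      ∃ g : GLm p 2, ∀ x ∈ H₃, IsSingerNormal n (g * x * g⁻¹)) :
    ¬ budget p 2 1 (2 + ε) <
      ((Nat.card H₁ * Nat.card H₂ * Nat.card H₃ : ℕ) : ℝ) ^ ((2 + ε) / 3) := by
  intro hwit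
  have hp3 : 3 ≤ p := by omega
  obtain ⟨hf₁, hf₂, hf₃⟩ := levelOne_witness_free_vector hp3 hε hε1 htpp hdesign hwit
  obtain ⟨e₁, e₂, e₃, -⟩ := familyI_of_images_le hp7 hε hε1 htpp hwit
    (image_le_of_conj_cartan hp3 hn h₁ hf₁) (image_le_of_conj_cartan hp3 hn h₂ hf₂)
    (image_le_of_conj_cartan hp3 hn h₃ hf₃)
  -- the split branch is impossible: image of order exactly `p + 1` in `N(T_s)`
  have key : ∀ {H : Subgroup (GLm p 2)},
      ((∃ g : GLm p 2, ∀ x ∈ H, IsMonomial (g * x * g⁻¹)) ∨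
        ∃ g : GLm p 2, ∀ x ∈ H, IsSingerNormal n (g * x * g⁻¹)) →
      Nat.card (H.map (QuotientGroup.mk' (scalarHom p 2).range)) = p + 1 →
      ∃ g : GLm p 2, ∀ x ∈ H, IsSingerNormal n (g * x * g⁻¹) := by
    intro H hH hX
    rcases hH with ⟨g, hg⟩ | hs
    · exact (not_conj_monomial_of_image_eq hp7 hg hX).elim
    · exact hs
  exact no_levelOne_witness_of_conj_singerNormal hp7 hn hε hε1 htpp hdesign
    (key h₁ e₁) (key h₂ e₂) (key h₃ e₃) hwit

/-- Contrapositive packaging: a `(2,1)` level-one witness (`p ≥ 7`, `0 < ε ≤ 1`) has a member that is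
conjugate into NO Cartan normaliser — neither into `N(T_s)` nor into `N(C_n)`. -/
theorem exists_member_not_conj_cartan (hp7 : 7 ≤ p) {n : ZMod p}
    (hn : ∀ x : ZMod p, x * x ≠ n) {ε : ℝ} (hε : 0 < ε) (hε1 : ε ≤ 1)
    {H₁ H₂ H₃ : Subgroup (GLm p 2)} (htpp : SubgroupTPP H₁ H₂ H₃)
    (hdesign : ∃ c : Mat p 2 → ℂ, (∀ M, 1 < M.rank → c M = 0) ∧
      (∑ M, c M * ZMod.stdAddChar (Matrix.trace (M * ((1 : GLm p 2) : Mat p 2)))) = 1 ∧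
      ∀ a ∈ H₁, ∀ b ∈ H₂, ∀ g ∈ H₃, a * b * g ≠ 1 →
        (∑ M, c M *
          ZMod.stdAddChar (Matrix.trace (M * ((a * b * g : GLm p 2) : Mat p 2)))) = 0)
    (hwit : budget p 2 1 (2 + ε) <
      ((Nat.card H₁ * Nat.card H₂ * Nat.card H₃ : ℕ) : ℝ) ^ ((2 + ε) / 3)) :
    ∃ H : Subgroup (GLm p 2), (H = H₁ ∨ H = H₂ ∨ H = H₃) ∧
      (∀ g : GLm p 2, ∃ x ∈ H, ¬ IsMonomial (g * x * g⁻¹)) ∧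
      ∀ g : GLm p 2, ∃ x ∈ H, ¬ IsSingerNormal n (g * x * g⁻¹) := by
  by_contra hall
  push Not at hall
  have conv : ∀ {H : Subgroup (GLm p 2)},
      ((∀ g : GLm p 2, ∃ x ∈ H, ¬ IsMonomial (g * x * g⁻¹)) →
        ∃ g : GLm p 2, ∀ x ∈ H, IsSingerNormal n (g * x * g⁻¹)) →
      ((∃ g : GLm p 2, ∀ x ∈ H, IsMonomial (g * x * g⁻¹)) ∨
        ∃ g : GLm p 2, ∀ x ∈ H, IsSingerNormal n (g * x * g⁻¹)) := by
    intro H h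
    by_cases hm : ∃ g : GLm p 2, ∀ x ∈ H, IsMonomial (g * x * g⁻¹)
    · exact Or.inl hm
    · push Not at hm
      exact Or.inr (h hm)
  exact no_levelOne_witness_of_conj_cartan hp7 hn hε hε1 htpp hdesign
    (conv (hall H₁ (Or.inl rfl))) (conv (hall H₂ (Or.inr (Or.inl rfl))))
    (conv (hall H₃ (Or.inr (Or.inr rfl)))) hwit

end CartanMembers

end Summit.MatrixMultiplication.MatrixMultiplication.Theorems.SubgroupIdentityDesigns.Negative

end
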